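import Summits.CriticalPhenomena.PercolationContinuityZ3.Theorems.PercNearOneGluingNoHeavyLowerTailSunflowerMultiPetalKempeMarkedLemmaB
import HarnessLib
import HarnessLib.Audit

/-!
# `NoHeavyLowerTail` (crux stmt-CriticalPhenomena-4575): **LEMMA B AND ★ₖ FOR EVERY MULTIGRAPH WITH MARKS, in the tree's clutter language** —
# `0 ≤ QKW univ (ofClutter E)` and `0 ≤ ZK (ofClutter E)` for every family `E` of members of size `1` or `2` (kernel-checked, hypothesis-free)

Support file (seat `prim-l12-p2` gen 49; `--supports stmt-CriticalPhenomena-4575`; continuation of `…KempeMarkedLemmaB` (p609343: `MGraph.QcolM_nonneg`) and of the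
simple-graph bridge `…KempeBridge` (p413513: `QKW_ofClutter_eq_Qcol`)).  No `sorry`; nothing is asserted about the crux.
Memo: run/shared/lean/prim/prim-l12/prim-l12-p2/PROOF-LEMMA-B-MARKED-MULTIGRAPHS-g47.md §3 (corollaries).

* `MGraph.ofFamily E` — the marked multigraph of a family of members of size `1` (marks) or `2` (edges, with multiplicity = repetitions);
* `memCount_class_eq_cntM` — the number of members inside a colour class is the member count `cntM` of `ofFamily E`;
* **`QKW_ofClutter_eq_QcolM`** — `QKW univ (ofClutter E) = Q(ofFamily E)` (bridge, as p413513 for simple graphs);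
* **`QKW_univ_nonneg_of_card_le_two`**, **`ZK_ofClutter_nonneg_of_card_le_two`** — the conclusions of THEOREM 1′ (`QKW_univ_nonneg_of_clutterIdentificationQKW`,
  `ZK_nonneg_of_clutterIdentificationQKW`, p413615) WITHOUT the hypothesis CN′: Lemma B and ★ₖ hold for every multigraph with marks.
What this does NOT give: families with a member of size ≥ 3 (the general `ClutterBottomSlackK` / `PartitionLemmaK` stays open).
-/

namespace Summit.CriticalPhenomena.PercolationContinuityZ3.Theorems.SunflowerPartition.Kempe

open Finset

namespace MGraph

variable {V : Type*} [Fintype V] [LinearOrder V]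

/-! ## The marked multigraph of a family of members of size 1 or 2 -/

/-- The marked multigraph of a family: `mul a b` = number of members equal to `{a,b}` (`a ≠ b`), `mark a` = number of members equal to `{a}`. [this work] -/
def ofFamily {k : ℕ} (E : Fin k → Finset V) : MGraph V where
  mul a b := if a = b then 0 else (univ.filter fun i => E i = {a, b}).card
  mark a := (univ.filter fun i => E i = {a}).card
  symm a b := by
    by_cases h : a = b
    · simp [h]
    · have h' : ¬b = a := fun e => h e.symm
      simp only [if_neg h, if_neg h', pair_comm]
  loopless a := by simp

omit [Fintype V] in
/-- Two ordered pairs give the same unordered pair only if they agree. [this work] -/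
theorem pair_eq_pair_of_lt {a b x y : V} (hab : a < b) (hxy : x < y) (h : ({a, b} : Finset V) = {x, y}) : a = x ∧ b = y := by
  have ha : a ∈ ({x, y} : Finset V) := h ▸ mem_insert_self a {b}
  have hb : b ∈ ({x, y} : Finset V) := h ▸ mem_insert_of_mem (mem_singleton_self b)
  rw [mem_insert, mem_singleton] at ha hb
  rcases ha with ha | ha <;> rcases hb with hb | hb
  · exact absurd (ha.trans hb.symm) hab.ne
  · exact ⟨ha, hb⟩
  · rw [ha, hb] at hab; exact absurd (hxy.trans hab) (lt_irrefl _)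
  · exact absurd (ha.trans hb.symm) hab.ne

/-- **A single member inside a colour class**: for a member `e` of size `1` or `2`, the indicator `[e ⊆ class c]` is the `cntM`-style count of `e` as a mark
or as an edge. [this work] -/
theorem single_member_count (e : Finset V) (he : 1 ≤ e.card ∧ e.card ≤ 2) (σ : V → Fin 3) (c : Fin 3) :
    (∑ x, ∑ y, if x < y ∧ σ x = c ∧ σ y = c then (if e = {x, y} then 1 else 0) else 0)
      + (∑ x, if σ x = c then (if e = {x} then 1 else 0) else 0)
      = if e ⊆ univ.filter (fun v => σ v = c) then 1 else 0 := by
  obtain ⟨he1, he2⟩ := he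
  rcases Nat.lt_or_ge e.card 2 with h1 | h2
  · -- a singleton member {a}
    have hc1 : e.card = 1 := by omega
    obtain ⟨a, rfl⟩ := card_eq_one.1 hc1
    have hpair : ∀ x y : V, x < y → ({a} : Finset V) ≠ {x, y} := by
      intro x y hxy h
      have : ({x, y} : Finset V).card = 2 := card_pair_eq_two_iff.2 hxy.ne
      rw [← h, card_singleton] at this
      exact absurd this (by decide)
    have hz : (∑ x, ∑ y, if x < y ∧ σ x = c ∧ σ y = c then (if ({a} : Finset V) = {x, y} then 1 else 0) else 0) = 0 := by
      refine sum_eq_zero fun x _ => sum_eq_zero fun y _ => ?_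
      by_cases h : x < y ∧ σ x = c ∧ σ y = c
      · rw [if_pos h, if_neg (hpair x y h.1)]
      · rw [if_neg h]
    rw [hz, zero_add, sum_eq_single a (fun b _ hba => by
        have : ({a} : Finset V) ≠ {b} := fun h => hba (singleton_inj.1 h).symm
        simp [this]) (fun h => absurd (mem_univ a) h)]
    simp only [singleton_subset_iff, mem_filter, mem_univ, true_and, if_true]
  · -- a pair member {a, b}
    have hc2 : e.card = 2 := by omega
    obtain ⟨a₀, b₀, hab₀, rfl⟩ := card_eq_two.1 hc2
    -- order the pair
    obtain ⟨a, b, hab, he'⟩ : ∃ a b : V, a < b ∧ ({a₀, b₀} : Finset V) = {a, b} := by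
      rcases lt_or_gt_of_ne hab₀ with h | h
      · exact ⟨a₀, b₀, h, rfl⟩
      · exact ⟨b₀, a₀, h, pair_comm _ _⟩
    rw [he']
    have hsing : ∀ x : V, ({a, b} : Finset V) ≠ {x} := by
      intro x h
      have : ({a, b} : Finset V).card = 2 := card_pair_eq_two_iff.2 hab.ne
      rw [h, card_singleton] at this
      exact absurd this (by decide)
    have hz : (∑ x, if σ x = c then (if ({a, b} : Finset V) = {x} then 1 else 0) else 0) = 0 := by
      refine sum_eq_zero fun x _ => ?_
      simp [hsing x]
    rw [hz, add_zero]
    rw [sum_eq_single a (fun x _ hxa => sum_eq_zero fun y _ => ?_) (fun h => absurd (mem_univ a) h),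
      sum_eq_single b (fun y _ hyb => ?_) (fun h => absurd (mem_univ b) h)]
    · simp only [hab, true_and, if_true]
      by_cases h : σ a = c ∧ σ b = c
      · rw [if_pos h, if_pos]
        intro v hv
        rw [mem_insert, mem_singleton] at hv
        rw [mem_filter]
        rcases hv with rfl | rfl
        · exact ⟨mem_univ _, h.1⟩
        · exact ⟨mem_univ _, h.2⟩
      · rw [if_neg h, if_neg]
        intro hsub
        apply h
        exact ⟨(mem_filter.1 (hsub (mem_insert_self a {b}))).2, (mem_filter.1 (hsub (mem_insert_of_mem (mem_singleton_self b)))).2⟩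
    · by_cases h : a < y ∧ σ a = c ∧ σ y = c
      · rw [if_pos h, if_neg]
        intro h'
        exact hyb ((pair_eq_pair_of_lt hab h.1 h').2).symm
      · rw [if_neg h]
    · by_cases h : x < y ∧ σ x = c ∧ σ y = c
      · rw [if_pos h, if_neg]
        intro h'
        exact hxa ((pair_eq_pair_of_lt hab h.1 h').1).symm
      · rw [if_neg h]

/-- **Members inside a colour class = `cntM` of the family's multigraph** (families of members of size `1` or `2`). [this work] -/
theorem memCount_class_eq_cntM {k : ℕ} (E : Fin k → Finset V) (hE : ∀ i, 1 ≤ (E i).card ∧ (E i).card ≤ 2) (σ : V → Fin 3) (c : Fin 3) :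
    memCount E (univ.filter fun v => σ v = c) = (ofFamily E).cntM σ c := by
  unfold memCount cntM ofFamily
  simp only
  rw [card_filter]
  -- rewrite the multiplicities and marks as sums over the members and swap the sums
  have hmul : ∀ x y : V, (if x < y ∧ σ x = c ∧ σ y = c then (if x = y then 0 else (univ.filter fun i => E i = {x, y}).card) else 0)
      = ∑ i, (if x < y ∧ σ x = c ∧ σ y = c then (if E i = {x, y} then 1 else 0) else 0) := by
    intro x y
    by_cases h : x < y ∧ σ x = c ∧ σ y = c
    · simp only [if_pos h, if_neg h.1.ne, card_filter]
    · simp only [if_neg h, sum_const_zero]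
  have hmark : ∀ x : V, (if σ x = c then (univ.filter fun i => E i = {x}).card else 0) = ∑ i, (if σ x = c then (if E i = {x} then 1 else 0) else 0) := by
    intro x
    by_cases h : σ x = c
    · simp only [if_pos h, card_filter]
    · simp only [if_neg h, sum_const_zero]
  simp only [hmul, hmark]
  have hsw1 : (∑ x : V, ∑ y : V, ∑ i : Fin k, if x < y ∧ σ x = c ∧ σ y = c then (if E i = {x, y} then 1 else 0) else 0)
      = ∑ i : Fin k, ∑ x : V, ∑ y : V, if x < y ∧ σ x = c ∧ σ y = c then (if E i = {x, y} then 1 else 0) else 0 := by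
    calc (∑ x : V, ∑ y : V, ∑ i : Fin k, if x < y ∧ σ x = c ∧ σ y = c then (if E i = {x, y} then 1 else 0) else 0)
        = ∑ x : V, ∑ i : Fin k, ∑ y : V, if x < y ∧ σ x = c ∧ σ y = c then (if E i = {x, y} then 1 else 0) else 0 :=
          sum_congr rfl (fun x _ => sum_comm)
      _ = _ := sum_comm
  have hsw2 : (∑ x : V, ∑ i : Fin k, if σ x = c then (if E i = {x} then 1 else 0) else 0)
      = ∑ i : Fin k, ∑ x : V, if σ x = c then (if E i = {x} then 1 else 0) else 0 := sum_comm
  rw [hsw1, hsw2, ← sum_add_distrib]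
  exact (sum_congr rfl fun i _ => (single_member_count (E i) (hE i) σ c).symm)

/-- **BRIDGE**: for a family of members of size `1` or `2`, the bottom-spectator functional of its coloured clutter on the whole cube is the Lemma-B
functional of its marked multigraph: `QKW univ (ofClutter E) = Q(ofFamily E)`. [this work] -/
theorem QKW_ofClutter_eq_QcolM {k : ℕ} (E : Fin k → Finset V) (hE : ∀ i, 1 ≤ (E i).card ∧ (E i).card ≤ 2) :
    (MSunflower.ofClutter E).QKW univ = (ofFamily E).QcolM := by
  have hne : ∀ i, (E i).Nonempty := fun i => card_pos.1 (by have := (hE i).1; omega)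
  have h1 : (MSunflower.ofClutter E).QKW univ = ∑ q ∈ pparts (univ : Finset V), lbW (typeOf E univ q) := by
    unfold MSunflower.QKW
    rw [nested_eq_sum_filter]
    refine sum_congr rfl fun q hq => ?_
    have hd : Disjoint q.1 q.2 := (mem_filter.1 hq).2
    have h13 : Disjoint q.1 (univ \ (q.1 ∪ q.2)) := Finset.disjoint_sdiff.mono_left subset_union_left
    have h23 : Disjoint q.2 (univ \ (q.1 ∪ q.2)) := Finset.disjoint_sdiff.mono_left subset_union_right
    exact qK_lab_eq_lbW E hne hd h13 h23
  rw [h1]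
  unfold QcolM
  symm
  refine sum_nbij' classes ofClasses (fun σ _ => by convert classes_mem_pparts σ) (fun q _ => mem_univ _)
    (fun σ _ => ofClasses_classes σ) (fun q hq => classes_ofClasses (by convert hq)) (fun σ _ => ?_)
  have h3 : (univ : Finset V) \ ((classes σ).1 ∪ (classes σ).2) = univ.filter (fun v => σ v = 2) := by convert third_class σ
  rw [typeOf, h3]
  have hc : ∀ c : Fin 3, capOf E ((univ : Finset V).filter fun v => σ v = c) = cap3 ((ofFamily E).cntM σ c) := fun c => by
    apply Fin.ext
    show min (memCount E ((univ : Finset V).filter fun v => σ v = c)) 2 = min ((ofFamily E).cntM σ c) 2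
    rw [memCount_class_eq_cntM E hE]
  change lbW ((ofFamily E).ctypeM σ) = lbW (capOf E ((univ : Finset V).filter fun v => σ v = 0), capOf E ((univ : Finset V).filter fun v => σ v = 1),
    capOf E ((univ : Finset V).filter fun v => σ v = 2))
  rw [hc, hc, hc]
  rfl

/-- Lemma B for the family, linear-order form. [this work] -/
theorem QKW_univ_nonneg_lin {k : ℕ} (E : Fin k → Finset V) (hE : ∀ i, 1 ≤ (E i).card ∧ (E i).card ≤ 2) :
    0 ≤ (MSunflower.ofClutter E).QKW univ := by
  rw [QKW_ofClutter_eq_QcolM E hE]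
  exact QcolM_nonneg _

end MGraph

/-! ## The conclusions of THEOREM 1′, unconditionally -/

/-- **LEMMA B FOR EVERY MULTIGRAPH WITH MARKS** (the conclusion of `QKW_univ_nonneg_of_clutterIdentificationQKW`, p413615, without the hypothesis CN′):
for every family of members of size `1` or `2`, `0 ≤ QKW univ (ofClutter E)`. [this work] -/
theorem QKW_univ_nonneg_of_card_le_two {β : Type*} [Fintype β] [DecidableEq β] {k : ℕ} (E : Fin k → Finset β)
    (hE : ∀ i, 1 ≤ (E i).card ∧ (E i).card ≤ 2) : 0 ≤ (MSunflower.ofClutter E).QKW univ := by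
  classical
  letI : LinearOrder β := LinearOrder.lift' (Fintype.equivFin β) (Fintype.equivFin β).injective
  convert MGraph.QKW_univ_nonneg_lin E hE

/-- **★ₖ FOR EVERY MULTIGRAPH WITH MARKS** (the conclusion of `ZK_nonneg_of_clutterIdentificationQKW` without CN′): `0 ≤ ZK (ofClutter E)` for every family of
members of size `1` or `2`. [this work] -/
theorem ZK_ofClutter_nonneg_of_card_le_two {β : Type*} [Fintype β] [DecidableEq β] {k : ℕ} (E : Fin k → Finset β)
    (hE : ∀ i, 1 ≤ (E i).card ∧ (E i).card ≤ 2) : 0 ≤ (MSunflower.ofClutter E).ZK := by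
  rw [← (MSunflower.ofClutter E).ZKW_univ]
  exact le_trans (QKW_univ_nonneg_of_card_le_two E hE) ((MSunflower.ofClutter E).QKW_le_ZKW univ)

end Summit.CriticalPhenomena.PercolationContinuityZ3.Theorems.SunflowerPartition.Kempe
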